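import Mathlib
import Literature.Analysis.FluidPDE.HardSphereCollisionRecord
import Literature.MathematicalPhysics.KineticTheory.HardSphereEuler

/-!
# Sketch — crux-ideate stmt-AtomisticToContinuum-14535 (OneFlightLayeredChaos), ideator 1, round 1

First lemmas of the two idea cards (`palm-inversion-past-insensitivity`,
`collision-time-coordinates`). They need not be proved here; they must elaborate.
-/

open scoped BigOperators
open MeasureTheory

namespace Summit.AtomisticToContinuum.HydrodynamicLimit.Cruxes.OneFlightLayeredChaos.IdeatorOne

/-- Card `palm-inversion-past-insensitivity`, first lemma (finite skeleton of the Bayes/TV step):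
prior `p ⊗ q` on `Ω × Y`, data `G : Ω → Y → D`, bounded mark functional `f` of `ω` (think
`f = 1_B ∘ outDir`, `p` = flux law of the contact normal, `q` = Gibbs–Palm law of everything else,
`G` = coarse past ∘ backward flow). The `L¹(data)`-defect of `f` against its prior mean is at most
the `p ⊗ p`-average total variation between the data laws under `ω` and under `ω'`. -/
theorem bayes_tv_defect {Ω Y D : Type*} [Fintype Ω] [Fintype Y] [Fintype D] [DecidableEq D]
    (p : Ω → ℝ) (q : Y → ℝ) (hp : ∀ ω, 0 ≤ p ω) (hq : ∀ y, 0 ≤ q y)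
    (hp1 : ∑ ω, p ω = 1) (G : Ω → Y → D) (f : Ω → ℝ) (hf : ∀ ω, |f ω| ≤ 1) :
    ∑ d, |∑ ω, ∑ y, p ω * q y * (if G ω y = d then (1 : ℝ) else 0) * (f ω - ∑ ω', p ω' * f ω')|
      ≤ 2 * ∑ ω, ∑ ω', p ω * p ω' *
          ∑ d, |(∑ y, q y * (if G ω y = d then (1 : ℝ) else 0))
                - (∑ y, q y * (if G ω' y = d then (1 : ℝ) else 0))| := by
  sorry

/-- Card `collision-time-coordinates`, first lemma (the atom of the gap rigidity matrix): at a
collision with contact normal `ω` and incoming relative velocity `g`, `⟪ω, g⟫ ≠ 0`, a relative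
position offset `δ` of the pair moves the contact normal by `ε⁻¹ • (δ - (⟪ω, δ⟫ / ⟪ω, g⟫) • g)`;
this transverse offset vanishes exactly on the line spanned by `g`: the collision TIME is the only
free coordinate of a braced pair, the two transverse components are pinned by `ω`. -/
theorem transverse_offset_eq_zero_iff
    (ω g δ : Literature.MathematicalPhysics.KineticTheory.V3)
    (hg : inner ℝ ω g ≠ 0) :
    δ - (inner ℝ ω δ / inner ℝ ω g) • g = 0 ↔ ∃ c : ℝ, δ = c • g := by
  sorry

/-- Same card, the affine chart in its smallest instance: two free particles with velocities
`va, vb` started at `xa, xb` are at contact with normal `ω` (diameter `ε`) at time `t` iff the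
initial relative position is the AFFINE expression `ε • ω - t • (va - vb)` of (collision time,
contact normal): on a forest-type gap the hidden coordinates given the two-snapshot exact-velocity
past are the component translations and the collision times, entering affinely. -/
theorem contact_affine_chart (xa xb va vb ω : Literature.MathematicalPhysics.KineticTheory.V3)
    (ε t : ℝ) :
    (xa + t • va) - (xb + t • vb) = ε • ω ↔ xa - xb = ε • ω - t • (va - vb) := by
  constructor <;> intro h
  · have : xa - xb = (xa + t • va) - (xb + t • vb) - t • (va - vb) := by
      simp [smul_sub]; abel
    rw [this, h]
  · rw [show (xa + t • va) - (xb + t • vb) = (xa - xb) + t • (va - vb) by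
      simp [smul_sub]; abel, h]
    abel

end Summit.AtomisticToContinuum.HydrodynamicLimit.Cruxes.OneFlightLayeredChaos.IdeatorOne
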